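import Summits.HodgeConjecture.CorCM.AndreProductFormBiproduct
import Summits.HodgeConjecture.HodgeConjecture.Theorems.PadicSemiregularLiftHodgeAbelianVarietiesAndreMaskedComponent
import Literature.AlgebraicGeometry.Motives.AbelianVarietyCohomologyExteriorH1
import Mathlib.LinearAlgebra.ExteriorPower.Basis
import Mathlib.LinearAlgebra.Matrix.Permutation
import HarnessLib

/-!
# COR-CM (cell `pub-hodgecm2`), A1 line — wedge-basis coordinates on `Hᵈ` of a complex abelian variety,
# and line coordinates on `H¹` of a finite biproduct of CM-typed realisations

HONEST FRAMING (cell pub-hodgecm2 / COR-CM, seat b30 gen 11; COUNT-NEUTRAL — no binder row of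
`HOME/BINDER-OWNERS.md`, no case of the Hodge conjecture, nothing about algebraic cycles).  Bookkeeping for step
L5 of `HOME/pub-hodgecm2-lit-andre-3/A1-BLUEPRINT.md` (the "`𝔅`-coefficient of `h^*(w_τ)` on the face
monomial"), on the tree's real carriers:

* for a complex abelian variety `B` and an ORDERED basis `L` of `H¹(B(ℂ); ℂ)`, the WEDGE BASIS
  `Bw = (L.exteriorPower d).map (hΛ.equiv d)` of `Hᵈ(B(ℂ); ℂ)` (`H• = ⋀• H¹`, the tree's theorem
  `AbelianVariety.hasExteriorCohomologyH1_complexPoints`; Mathlib's `Basis.exteriorPower`) — passed as a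
  hypothesis `hBw : Bw = …` so that this file declares no definition:
  `wedgeBasis_apply` (`Bw S = L i₁ ⌣ ⋯ ⌣ L i_d` along the increasing enumeration of `S`),
  `map_wedgeBasis_of_diagonal` (an endomorphism diagonal on `L` acts on `Bw S` by `∏_{i ∈ S} a_i` — the
  statement of the crux module `exists_andreWedgeBasis`, re-proved for THIS basis),
  `wedgeBasis_repr_cupPowOne` (the `S`-coordinate of `w₀ ⌣ ⋯ ⌣ w_{d-1}` is the `d × d` MINOR
  `det (L.coord (S_k) (w_i))`, Mathlib's `exteriorPower.ιMultiDual_apply_ιMulti`);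
* `det_of_monomial_ne_zero` — a matrix with exactly one non-zero entry in each row, in the columns of a
  permutation, has non-zero determinant;
* for a finite biproduct `⨁ A_j` with bases `v j` of the factors: the line coordinates of `π_j^* z`
  (`biprodBasis_repr_map_π`), and of an eigenvector (`repr_eq_zero_of_apply_eq_smul`,
  `repr_eq_zero_of_mem_eigenline_of_ne`, `eq_repr_smul_of_mem_eigenline`).

THEOREMS ONLY; no `sorry`; axioms `propext`, `Classical.choice`, `Quot.sound`.

## References
* [LangeBirkenhake1992] H. Lange, Ch. Birkenhake, *Complex Abelian Varieties* (1992), §1.1, Lemma 1.1.17 and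
  Exercise 1.1.6 (7) (`H•(X, ℂ) = ⋀• H¹`).
* [Lang2002] S. Lang, *Algebra*, 3rd ed. (2002), XIX §1 (the coordinates of `x₁ ∧ ⋯ ∧ x_p` in the basis of
  `p`-fold wedges are the `p × p` minors) — as formalised in Mathlib `LinearAlgebra/ExteriorPower/Basis`;
  XIII §4 (determinants of monomial matrices).
-/

noncomputable section

namespace Summit.HodgeConjecture.CorCM.WedgeCoordinates

open CategoryTheory CategoryTheory.Limits NumberField
open Literature.AlgebraicTopology.SingularHomology
open Literature.AlgebraicGeometry Literature.AlgebraicGeometry.Motives Literature.AlgebraicGeometry.HodgeTheory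
open Summit.HodgeConjecture.HodgeConjecture.Theorems.HodgeAbelianVarieties.CMPivotAndre

/-! ## The wedge basis of `Hᵈ(B(ℂ); ℂ)` attached to an ordered basis of `H¹` -/

section Wedge

variable {B : AbelianVariety ℂ} {ι : Type*} [LinearOrder ι]
variable (L : Module.Basis ι ℂ (complexBetti B.X 1)) (d : ℕ)
variable (Bw : Module.Basis (Set.powersetCard ι d) ℂ (complexBetti B.X d))
  (hBw : Bw = (L.exteriorPower d).map ((AbelianVariety.hasExteriorCohomologyH1_complexPoints B).equiv d))

include hBw

/-- The wedge basis vector of `S` is the iterated cup product of the `L i`, `i ∈ S`, in increasing order.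
[cite: LangeBirkenhake1992, Lemma 1.1.17 and Exercise 1.1.6 (7)] -/
theorem wedgeBasis_apply (S : Set.powersetCard ι d) :
    Bw S = cupPowOne ℂ (ComplexPoints B.X) d (fun k => L (Set.powersetCard.ofFinEmbEquiv.symm S k)) := by
  rw [hBw, Module.Basis.map_apply, exteriorPower.basis_apply, HasExteriorCohomologyH1.equiv_apply,
    exteriorPower.ιMulti_family, wedgeToCup_ιMulti]
  rfl

/-- **An endomorphism diagonal on `L` is diagonal on the wedge basis**, with eigenvalue the product over `S`
(naturality of iterated cup products, `map_cupPowOne`). [cite: LangeBirkenhake1992, Lemma 1.1.17 and Exercise 1.1.6 (7)] -/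
theorem map_wedgeBasis_of_diagonal (f : B ⟶ B) (a : ι → ℂ)
    (ha : ∀ i, complexBetti.map f.hom.hom.hom 1 (L i) = a i • L i) (S : Set.powersetCard ι d) :
    complexBetti.map f.hom.hom.hom d (Bw S) = (∏ i ∈ (S : Finset ι), a i) • Bw S := by
  classical
  -- adapted from the crux module `exists_andreWedgeBasis` (same computation, for this explicit basis)
  rw [wedgeBasis_apply L d Bw hBw S]
  change singularCohomology.map ℂ ℂ (AlgPoints.mapContinuous (L := ℂ) f.hom.hom.hom) d (cupPowOne ℂ _ d _) = _
  rw [map_cupPowOne]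
  have e : (fun k => singularCohomology.map ℂ ℂ (AlgPoints.mapContinuous (L := ℂ) f.hom.hom.hom) 1
      (L (Set.powersetCard.ofFinEmbEquiv.symm S k))) =
      fun k => a (Set.powersetCard.ofFinEmbEquiv.symm S k) • L (Set.powersetCard.ofFinEmbEquiv.symm S k) := by
    funext k
    exact ha _
  rw [e, MultilinearMap.map_smul_univ]
  congr 1
  have hinj : Function.Injective (Set.powersetCard.ofFinEmbEquiv.symm S) :=
    (Set.powersetCard.ofFinEmbEquiv.symm S).injective
  rw [← Finset.prod_image (f := a) hinj.injOn]
  refine Finset.prod_congr ?_ fun _ _ => rfl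
  ext i
  rw [Finset.mem_image]
  constructor
  · rintro ⟨k, _, rfl⟩
    exact (Set.powersetCard.mem_range_ofFinEmbEquiv_symm_iff_mem S _).1 ⟨k, rfl⟩
  · intro hi
    obtain ⟨k, hk⟩ := (Set.powersetCard.mem_range_ofFinEmbEquiv_symm_iff_mem S i).2 hi
    exact ⟨k, Finset.mem_univ _, hk⟩

/-- **Wedge coordinates of an iterated cup product are minors**: the `S`-coordinate of `w₀ ⌣ ⋯ ⌣ w_{d-1}`
in the wedge basis is `det (L.coord (S_k) (w_i))_{i,k}`, `S_k` the increasing enumeration of `S`.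
[cite: Lang2002, XIX §1] -/
theorem wedgeBasis_repr_cupPowOne (w : Fin d → complexBetti B.X 1) (S : Set.powersetCard ι d) :
    Bw.repr (cupPowOne ℂ (ComplexPoints B.X) d w) S =
      (Matrix.of fun i k => L.coord (Set.powersetCard.ofFinEmbEquiv.symm S k) (w i)).det := by
  set hΛ := AbelianVariety.hasExteriorCohomologyH1_complexPoints B
  have hx : cupPowOne ℂ (ComplexPoints B.X) d w = hΛ.equiv d (exteriorPower.ιMulti ℂ d w) := by
    rw [HasExteriorCohomologyH1.equiv_apply, wedgeToCup_ιMulti]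
  rw [hBw, hx, Module.Basis.map_repr, LinearEquiv.trans_apply, LinearEquiv.symm_apply_apply,
    exteriorPower.basis_repr_apply, exteriorPower.ιMultiDual_apply_ιMulti]

end Wedge

/-! ## Monomial matrices have non-zero determinant -/

section Monomial

variable {n : Type*} [Fintype n] [DecidableEq n]

/-- A matrix supported on the graph of a permutation `σ` (`M i k = 0` unless `k = σ i`) is
`diagonal (fun i => M i (σ i)) * σ.toPEquiv.toMatrix`. [folklore] -/
theorem eq_diagonal_mul_perm (M : Matrix n n ℂ) (σ : Equiv.Perm n) (hM : ∀ i k, k ≠ σ i → M i k = 0) :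
    M = Matrix.diagonal (fun i => M i (σ i)) * σ.toPEquiv.toMatrix := by
  ext i k
  rw [Matrix.mul_apply, Finset.sum_eq_single i]
  · rw [Matrix.diagonal_apply_eq, PEquiv.toMatrix_apply, Equiv.toPEquiv_apply]
    by_cases hk : k = σ i
    · subst hk; simp
    · rw [hM i k hk]
      simp [Option.mem_def, Ne.symm hk]
  · intro j _ hji
    rw [Matrix.diagonal_apply_ne _ (Ne.symm hji), zero_mul]
  · intro h; exact absurd (Finset.mem_univ i) h

/-- **Monomial matrices are invertible**: if `M i k = 0` unless `k = σ i` and `M i (σ i) ≠ 0` for all `i`,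
then `det M ≠ 0` (`det M = sign σ · ∏ M i (σ i)`). [folklore] -/
theorem det_of_monomial_ne_zero (M : Matrix n n ℂ) (σ : Equiv.Perm n) (hM : ∀ i k, k ≠ σ i → M i k = 0)
    (hdiag : ∀ i, M i (σ i) ≠ 0) : M.det ≠ 0 := by
  rw [eq_diagonal_mul_perm M σ hM, Matrix.det_mul, Matrix.det_diagonal, Matrix.det_permutation]
  refine mul_ne_zero (Finset.prod_ne_zero_iff.mpr fun i _ => hdiag i) ?_
  exact Int.cast_ne_zero.mpr (Units.ne_zero _)

end Monomial

/-! ## Line coordinates on `H¹` of a finite biproduct -/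

section Biproduct

open Literature.NumberTheory.Automorphic.PicardCM (eigenline mem_eigenline_iff)

variable {J : Type} [Fintype J] [DecidableEq J] (A : J → AbelianVariety ℂ)
variable {I : Type} [Fintype I] [DecidableEq I] (v : ∀ j, Module.Basis I ℂ (complexBetti (A j).X 1))

/-- **Coordinates of `π_j^* z`**: in the line basis `(π_j)^* (v j i)` of `H¹(⨁ A)`, the class `π_j^* z` has
coordinates `(v j).repr z` in slot `j` and `0` in the other slots. [cite: LangeBirkenhake1992, §1.1 (p. 19)] -/
theorem biprodBasis_repr_map_π (j : J) (z : complexBetti (A j).X 1) (p : J × I) :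
    (AndreProductForm.biprodBasis A v).repr (complexBetti.map (biproduct.π A j).hom.hom.hom 1 z) p =
      if p.1 = j then (v j).repr z p.2 else 0 := by
  classical
  -- expand `z` in the basis `v j` and pull back term by term
  have hz : complexBetti.map (biproduct.π A j).hom.hom.hom 1 z =
      ∑ i, (v j).repr z i • AndreProductForm.biprodBasis A v (j, i) := by
    conv_lhs => rw [← (v j).sum_repr z]
    rw [map_sum]
    refine Finset.sum_congr rfl fun i _ => ?_
    rw [map_smul, AndreProductForm.biprodBasis_apply]
  rw [hz, map_sum, Finsupp.finsetSum_apply]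
  simp only [map_smul, Module.Basis.repr_self, Finsupp.smul_single, smul_eq_mul, mul_one,
    Finsupp.single_apply]
  rcases p with ⟨j', i'⟩
  by_cases hj : j' = j
  · subst hj
    rw [Finset.sum_eq_single i']
    · simp
    · intro i _ hi
      rw [if_neg (fun h => hi (Prod.mk.inj h).2)]
    · intro h; exact absurd (Finset.mem_univ _) h
  · rw [if_neg hj]
    refine Finset.sum_eq_zero fun i _ => ?_
    rw [if_neg (fun h => hj (Prod.mk.inj h).1.symm)]

/-- **An eigenvector has no coordinate on basis vectors of a different eigenvalue**: if `T` is diagonal on the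
basis `w` with eigenvalues `lam` and `T z = c • z`, then `w.repr z i = 0` whenever `lam i ≠ c`. [folklore] -/
theorem repr_eq_zero_of_apply_eq_smul {M : Type*} [AddCommGroup M] [Module ℂ M] {I' : Type*} [Fintype I']
    (T : M →ₗ[ℂ] M) (w : Module.Basis I' ℂ M) (lam : I' → ℂ) (hT : ∀ i, T (w i) = lam i • w i)
    {z : M} {c : ℂ} (hz : T z = c • z) {i : I'} (hi : lam i ≠ c) : w.repr z i = 0 := by
  have h1 : w.repr (T z) i = lam i * w.repr z i := repr_apply_of_diagonal w T lam hT z i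
  rw [hz, map_smul, Finsupp.smul_apply, smul_eq_mul] at h1
  have h2 : (lam i - c) * w.repr z i = 0 := by rw [sub_mul, ← h1, sub_self]
  rcases mul_eq_zero.mp h2 with h | h
  · exact absurd (sub_eq_zero.mp h) hi
  · exact h

variable {K : Type} [Field K]

/-- **A vector of the `s`-eigenline has no coordinate on the other eigenvectors**: if `v` is a basis of
joint eigenvectors of an action `θ` of `K` (`v σ ∈ eigenline θ σ`) and `z ∈ eigenline θ s`, then
`v.repr z σ = 0` for `σ ≠ s` (pick `a` separating `σ` from `s` and compare `θ(a) z = s(a) z` coordinatewise).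
[folklore] -/
theorem repr_eq_zero_of_mem_eigenline_of_ne {M : Type*} [AddCommGroup M] [Module ℂ M] [Fintype (K →+* ℂ)]
    (θ : K →+* Module.End ℂ M) (w : Module.Basis (K →+* ℂ) ℂ M) (hw : ∀ σ, w σ ∈ eigenline θ σ)
    {s : K →+* ℂ} {z : M} (hz : z ∈ eigenline θ s) {σ : K →+* ℂ} (hσ : σ ≠ s) : w.repr z σ = 0 := by
  obtain ⟨a, ha⟩ : ∃ a : K, σ a ≠ s a := not_forall.mp fun h => hσ (RingHom.ext h)
  exact repr_eq_zero_of_apply_eq_smul (θ a) w (fun τ => τ a) (fun τ => (mem_eigenline_iff θ τ).1 (hw τ) a)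
    ((mem_eigenline_iff θ s).1 hz a) ha

/-- A vector of the `s`-eigenline is the multiple `(v.repr z s) • v s` of the basis eigenvector. [folklore] -/
theorem eq_repr_smul_of_mem_eigenline {M : Type*} [AddCommGroup M] [Module ℂ M] [Fintype (K →+* ℂ)]
    (θ : K →+* Module.End ℂ M) (w : Module.Basis (K →+* ℂ) ℂ M) (hw : ∀ σ, w σ ∈ eigenline θ σ)
    {s : K →+* ℂ} {z : M} (hz : z ∈ eigenline θ s) : z = w.repr z s • w s := by
  classical
  refine w.ext_elem fun σ => ?_
  rw [map_smul, Finsupp.smul_apply, Module.Basis.repr_self, Finsupp.single_apply, smul_eq_mul]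
  by_cases h : s = σ
  · subst h; simp
  · rw [if_neg h, mul_zero]
    exact repr_eq_zero_of_mem_eigenline_of_ne θ w hw hz (Ne.symm h)

end Biproduct

end Summit.HodgeConjecture.CorCM.WedgeCoordinates

end
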